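import Summits.ResolutionOfSingularities.ResolutionOfSingularities.Theorems.EquisingularLiftEquisingularLiftNatCarrierDeltaComap
import Literature.AlgebraicGeometry.Resolution.StrictTransformDistinct
import HarnessLib

/-!
# [OURS · L1 W4.5(b) · EL♮(3)] T-M1-SCHEME (F⁺5): «THE SPECIAL FIBRE OF THE STRICT TRANSFORM» — `St_τ(K) · 𝒪_{F₂} = St_υ(K̄)`
# through the model squares, for a hypersurface `K` of order `d` along the centre which is EQUIMULTIPLE at the special point

Crux `EquisingularLiftNat` = stmt-ResolutionOfSingularities-20038 (child EL♮(3) = stmt-ResolutionOfSingularities-20148), route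
EquisingularLift, line `sections`; registered stubs `stub_elnat_tcDeltaPointResolution` / `stub_elnat_three_isolated_nontc`
(skeleton v6, res-L1-w45b-lead-2), draft stub `stub_elnat_tcPlusPointResolution` (TARGET-TCPLUS 1457ad81086910d2, DESIGN v6/v7
(TC⁺) «in-carrier point steps before the carrier curve»). Helper file `--supports stmt-ResolutionOfSingularities-20148 --as helper`
by res-L1-w45b-stub-1 (object T-M1-SCHEME (β), res-L1-w45b-lead-2 GO 2026-08-27T09:23:39Z). HONEST FRAMING: OURS (cell res-hironaka,
slot W4.5(b)); NOT a statement of any manuscript; AI-written, weaker than expert review. No `sorry`; standard axioms.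

WHAT. The hypothesis `C.comap j = D` of res-D-pv-029's `modelStep` (…NatModelStep: «the upstairs centre `C` has special fibre the
downstairs centre `D`») DISCHARGED for the PROXIMITY-LIFT / M1 centres of DESIGN v6 (TC⁺) — strict transforms `C = St_τ V(K)` of a
hypersurface `K` through a section (res-L1-w45b-plan-1 PLANNER-MEMO M1, res-L1-w45b-lead-2 «`V(G̃)` equimultiple along `s_q` ⇒
`St_{s_q} V(G̃)` has special fibre EXACTLY `St_q(Z)`»; ring form = res-L1-w45b-stub-3's T-M1-EXACT p515745
`map_blowupAlgebraMap_strictTransformIdeal_eq`) — at the level of IDEAL SHEAVES and WITHOUT any chart base change: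

* `exists_stalk_strictTransformIdeal_of_eq` — p-form of res-type-100's stalk theorem (`exists_stalk_strictTransformIdeal_sup_comap`,
  p509910) keeping the two conjuncts used here: at `x'` with `τ x' = p ∈ supp J`, under the CONE PACK at `p` (`J_p = (c)`, `c`
  quasi-regular, `𝒪/(c)` a domain, `K_p = (Φ(c))` with `Φ` a FORM of degree `d`, `Φ̄ ≠ 0` — NOTE: every hypersurface of order
  exactly `d` along `V(J)` near `p` has this shape, the coefficients of `Φ` being allowed in `𝒪_{X',p}`: write `G = Σ_{|α|=d} g_α c^α`),
  for a chart presentation `χ` of `𝒪_{X₁,x'}`: `E_{x'} = (χ t)` and **`St_τ(K)_{x'} = (χ Φ(c/c_j))`**;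
* **`comap_strictTransformIdeal_eq_of_model`** — SETTING of res-D-pv-029's (v) (…NatCarrierDeltaComap p517803) verbatim:
  `τ : X₁ → X'` a blow-up along `J`, `υ : F₂ → F₁` a blow-up of the reduced closed point `x`, `j : F₁ → X'`, `j₂ : F₂ → X₁` with
  `j₂ ≫ τ = υ ≫ j` and `J · 𝒪_{F₁} = 𝔪_x` (the model squares of T-ISO-0⁺, `modelPointStep_chain'` p512154), `F₁, F₂` integral,
  the cone pack at `p = j x` and its image downstairs (`c̄ = j^♯_x ∘ c` quasi-regular, `Φ ≢ 0 mod 𝔪_p` — this is EXACTLY the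
  EQUIMULTIPLICITY of `V(K)` along the centre AT THE SPECIAL POINT: `ord_x K̄ = d = ord_{V(J)} K`). CONCLUSION:
  **`(strictTransformIdeal τ J K).comap j₂ = strictTransformIdeal υ 𝓘_{x} (K.comap j)`** — the strict transform of `V(K)` along
  the section restricts to the special fibre as the strict transform of the special fibre `V(K̄)` at the point: NO exceptional
  component. Off `υ⁻¹{x}` both sides are the total transform; over `x` the two stalk presentations (upstairs at `j₂ y`, downstairs
  at `y`) give `(Φ(q))` and `(Φ̄(q′))` in the domain `𝒪_{F₂,y}`, and `(t) = (t′) = E₂_y` forces `q′ = u • q`, `Φ̄(q′) = uᵈ Φ(q)` —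
  res-D-pv-029's argument for (v), run on the strict-transform conjunct instead of the sup;
* (v) itself (`comap_strictTransformIdeal_sup_comap_eq_of_model`, p517803) is the sup of this identity with the carrier identity
  `(J·𝒪_{X₁})·𝒪_{F₂} = 𝔪_x·𝒪_{F₂}` (`Scheme.IdealSheafData.comap_sup`); not restated here.

WHY IT MATTERS (TC⁺ / HΔ⁺). In DESIGN v6 (TC⁺) the upstairs centre after the in-carrier point steps is `St(D)`, `D = E ∩ V(K₁)`;
its ideal is `St(𝓘_E) ⊔ St(K₁)` (saturatedness of that sup = the sequel file …NatCarrierStrictTransformStalks), and BOTH summands are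
instances of this file: `𝓘_E` is a «cone of degree 1» through the section (`E` a regular divisor), `K₁` a cone of degree `m_q` with
`𝒪_{X₁}`-coefficients (the centred lift). With res-L1-w45b-stub-1's T-M1-FLAT (p517580) and res-L1-w45b-stub-3's regularity transfer
(p515745 (iv)) these are the entries `C.comap j = D`, `Flat`, `IsRegular` of `modelStep` for M1 centres.

References: …NatCarrierDeltaComap (p517803, res-D-pv-029), …NatCarrierDeltaStalks (p509910, res-type-100), …NatModelStep;
The Stacks Project, Tags 0804, 080C; U. Görtz, T. Wedhorn, *Algebraic Geometry I* (2020), (13.19), Prop. 13.91.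
-/

set_option linter.dupNamespace false -- mandated namespace `Summit.<Summit>.<Problem>` of this single-conjunct summit

noncomputable section

open CategoryTheory CategoryTheory.Limits AlgebraicGeometry TopologicalSpace Topology IsLocalRing
open Literature.AlgebraicGeometry.Resolution
open AlgebraicGeometry.Scheme.IdealSheafData

namespace Summit.ResolutionOfSingularities.ResolutionOfSingularities.Cruxes.EquisingularLiftNat.Sections

universe u

/-! ## The stalk of the strict transform, p-form -/

section PForm

variable {X' X₁ : Scheme.{u}} {τ : X₁ ⟶ X'} {J : X'.IdealSheafData}

set_option maxHeartbeats 400000 in -- chart algebra `blowupAlgebra` = subalgebra of a localisation: slow unification (as p509910)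
/-- **p-form of res-type-100's stalk theorem, strict-transform conjunct.** For a blow-up `τ : X₁ → X'` along `J`, a point `x'`
with `τ x' = p ∈ supp J`, and the cone pack at `p` (`J_p = (c)`, `c` quasi-regular, `𝒪_{X',p}/(c)` a domain, `K_p = (Φ(c))` for a
form `Φ` of degree `d` with `Φ̄ ≠ 0`): for some chart index `jj` and a ring map `χ : 𝒪_{X',p}[(c)/c_jj] → 𝒪_{X₁,x'}` extending `τ^♯`
(composed with `𝒪_{X',p} ≅ 𝒪_{X',τ x'}`), the stalk of the exceptional ideal is `(χ (c_jj/1))` and **the stalk of the strict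
transform `St_τ(K)` is `(χ Φ(c/c_jj))`**. [cite: StacksProject, Tag 0804] -/
theorem exists_stalk_strictTransformIdeal_of_eq [IsLocallyNoetherian X₁] (hτ : IsBlowup τ J) (K : X'.IdealSheafData) (x' : X₁)
    (p : X') (hp : τ x' = p) (hpJ : p ∈ (J.support : Set X')) {r : ℕ}
    (c : Fin r → X'.presheaf.stalk p) (hcJ : Ideal.span (Set.range c) = stalkIdeal J p) (hc : IsQuasiRegular c)
    [IsDomain (X'.presheaf.stalk p ⧸ Ideal.span (Set.range c))]
    {d : ℕ} (Φ : MvPolynomial (Fin r) (X'.presheaf.stalk p)) (hΦd : Φ.IsHomogeneous d)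
    (hΦ : MvPolynomial.map (Ideal.Quotient.mk (Ideal.span (Set.range c))) Φ ≠ 0)
    (hK : stalkIdeal K p = Ideal.span {MvPolynomial.eval c Φ}) :
    ∃ (jj : Fin r) (χ : blowupAlgebra (Ideal.span (Set.range c)) (c jj) →+* X₁.presheaf.stalk x'),
      (∀ a, χ (algebraMap _ _ a) = (τ.stalkMap x').hom ((X'.presheaf.stalkCongr (Inseparable.of_eq hp)).inv a)) ∧
      stalkIdeal (J.comap τ) x' =
        Ideal.span {χ (algebraMap _ (blowupAlgebra (Ideal.span (Set.range c)) (c jj)) (c jj))} ∧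
      stalkIdeal (strictTransformIdeal τ J K) x' = Ideal.span {χ (MvPolynomial.aeval (blowupAlgebra.frac c jj) Φ)} := by
  subst hp
  obtain ⟨jj, 𝔔, χ, e, hχ, -, -, hE, hSt, -, -⟩ :=
    exists_stalk_strictTransformIdeal_sup_comap hτ K x' hpJ c hcJ hc Φ hΦd hΦ hK
  refine ⟨jj, χ, fun a => ?_, hE, hSt⟩
  rw [hχ]
  simp [TopCat.Presheaf.stalkCongr]

end PForm

/-! ## (F⁺5): the strict transform restricts to the special fibre as the strict transform of the special fibre -/

set_option maxHeartbeats 1600000 in -- two instances of the chart-algebra stalk theorem (each 400000 in p509910) plus stalk transport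
/-- **T-M1-SCHEME (F⁺5) «the special fibre of the strict transform is the strict transform of the special fibre».** See the module
docstring: in the model-square setting of res-D-pv-029's (v), for a hypersurface `K` of order `d` along the centre near `p = j x`
(cone pack) which is EQUIMULTIPLE at the special point (`Φ ≢ 0 mod 𝔪_p`, `c̄` quasi-regular downstairs),
`(strictTransformIdeal τ J K).comap j₂ = strictTransformIdeal υ 𝓘_{x} (K.comap j)`. [cite: StacksProject, Tag 0804]
[cite: GortzWedhorn2020, (13.19) p. 414] [OURS · L1 W4.5b] T-M1-SCHEME toward `stub_elnat_three_isolated_nontc` /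
`stub_elnat_tcPlusPointResolution`; NOT a statement of the manuscript. -/
theorem comap_strictTransformIdeal_eq_of_model {X' X₁ F₁ F₂ : Scheme.{0}} (τ : X₁ ⟶ X')
    (J K : X'.IdealSheafData) (hτ : IsBlowup τ J) [IsLocallyNoetherian X₁] [IsLocallyNoetherian F₂]
    [IsIntegral F₁] [IsIntegral F₂] [IsLocallyNoetherian F₁]
    (j : F₁ ⟶ X') (υ : F₂ ⟶ F₁) (j₂ : F₂ ⟶ X₁) (hcomm : j₂ ≫ τ = υ ≫ j)
    (x : F₁) (hx : IsClosed ({x} : Set F₁))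
    (hυ : IsBlowup υ (vanishingIdeal ⟨{x}, hx⟩)) (hJ : J.comap j = vanishingIdeal ⟨{x}, hx⟩)
    -- the cone data at `j x`
    {r : ℕ} (c : Fin r → X'.presheaf.stalk (j x)) (hcJ : Ideal.span (Set.range c) = stalkIdeal J (j x))
    (hc : IsQuasiRegular c) [IsDomain (X'.presheaf.stalk (j x) ⧸ Ideal.span (Set.range c))]
    {d : ℕ} (Φ : MvPolynomial (Fin r) (X'.presheaf.stalk (j x))) (hΦd : Φ.IsHomogeneous d)
    (hΦ : MvPolynomial.map (Ideal.Quotient.mk (Ideal.span (Set.range c))) Φ ≠ 0)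
    (hK : stalkIdeal K (j x) = Ideal.span {MvPolynomial.eval c Φ})
    -- its image downstairs (equimultiplicity at the special point)
    (hcbar : IsQuasiRegular (fun i => (j.stalkMap x).hom (c i)))
    (hΦbar : MvPolynomial.map (Ideal.Quotient.mk (Ideal.span (Set.range fun i => (j.stalkMap x).hom (c i))))
      (MvPolynomial.map (j.stalkMap x).hom Φ) ≠ 0) :
    (strictTransformIdeal τ J K).comap j₂ = strictTransformIdeal υ (vanishingIdeal ⟨{x}, hx⟩) (K.comap j) := by
  classical
  -- adapted from `comap_strictTransformIdeal_sup_comap_eq_of_model` (…NatCarrierDeltaComap, res-D-pv-029)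
  -- the carrier identity `(J · 𝒪_{X₁}) · 𝒪_{F₂} = 𝔪_x · 𝒪_{F₂}`
  have hE : (J.comap τ).comap j₂ = (vanishingIdeal ⟨{x}, hx⟩ : F₁.IdealSheafData).comap υ := by
    rw [← hJ, ← Scheme.IdealSheafData.comap_comp, ← Scheme.IdealSheafData.comap_comp, hcomm]
  refine ext_of_forall_stalkIdeal_eq fun y => ?_
  by_cases hy : υ y = x
  · subst hy
    have hτx' : τ (j₂ y) = j (υ y) := by
      rw [← Scheme.Hom.comp_apply, hcomm, Scheme.Hom.comp_apply]
    have hxJ : j (υ y) ∈ (J.support : Set X') := by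
      have : υ y ∈ ((J.comap j).support : Set F₁) := by
        rw [hJ, Scheme.IdealSheafData.coe_support_vanishingIdeal]; rfl
      rw [Scheme.IdealSheafData.support_comap] at this
      exact this
    -- the downstairs cone data
    set cb : Fin r → F₁.presheaf.stalk (υ y) := fun i => (j.stalkMap (υ y)).hom (c i) with hcb
    set Φb : MvPolynomial (Fin r) (F₁.presheaf.stalk (υ y)) := MvPolynomial.map (j.stalkMap (υ y)).hom Φ with hΦb
    have hrange : Set.range cb = (j.stalkMap (υ y)).hom '' Set.range c := by
      rw [hcb]; exact Set.range_comp _ _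
    have hcbJ : Ideal.span (Set.range cb) = stalkIdeal (vanishingIdeal ⟨{υ y}, hx⟩ : F₁.IdealSheafData) (υ y) := by
      rw [← hJ, stalkIdeal_comap_eq_map_stalkMap, ← hcJ, Ideal.map_span, hrange]
    have hcb𝔪 : Ideal.span (Set.range cb) = maximalIdeal (F₁.presheaf.stalk (υ y)) := by
      rw [hcbJ, stalkIdeal_vanishingIdeal_singleton hx]
    haveI : IsDomain (F₁.presheaf.stalk (υ y) ⧸ Ideal.span (Set.range cb)) :=
      isDomain_quotient_span_of_span_eq_maximalIdeal hcb𝔪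
    have hΦbd : Φb.IsHomogeneous d := hΦd.map _
    have hevalb : (j.stalkMap (υ y)).hom (MvPolynomial.eval c Φ) = MvPolynomial.eval cb Φb := by
      rw [hΦb, MvPolynomial.eval_map, show MvPolynomial.eval c Φ = MvPolynomial.eval₂ (RingHom.id _) c Φ from rfl,
        MvPolynomial.eval₂_comp_left, RingHom.comp_id]
      rfl
    have hKb : stalkIdeal (K.comap j) (υ y) = Ideal.span {MvPolynomial.eval cb Φb} := by
      rw [stalkIdeal_comap_eq_map_stalkMap, hK, Ideal.map_span, Set.image_singleton, hevalb]
    have hyJ : υ y ∈ ((vanishingIdeal ⟨{υ y}, hx⟩ : F₁.IdealSheafData).support : Set F₁) := by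
      rw [Scheme.IdealSheafData.coe_support_vanishingIdeal]; rfl
    -- the two stalk presentations (strict-transform conjuncts)
    obtain ⟨jj, χ, hχ, hEu, hStu⟩ :=
      exists_stalk_strictTransformIdeal_of_eq hτ K (j₂ y) (j (υ y)) hτx' hxJ c hcJ hc Φ hΦd hΦ hK
    obtain ⟨j', 𝔔', χ', e', hχ', -, -, hEd, hStd, -, -⟩ :=
      exists_stalk_strictTransformIdeal_sup_comap hυ (K.comap j) y hyJ cb hcbJ hcbar Φb hΦbd hΦbar hKb
    -- everything in `A = 𝒪_{F₂,y}`
    set ψ : blowupAlgebra (Ideal.span (Set.range c)) (c jj) →+* F₂.presheaf.stalk y := (j₂.stalkMap y).hom.comp χ with hψ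
    set t : F₂.presheaf.stalk y := ψ (algebraMap _ _ (c jj)) with ht
    set t' : F₂.presheaf.stalk y := χ' (algebraMap _ _ (cb j')) with ht'
    set q : Fin r → F₂.presheaf.stalk y := fun l => ψ (blowupAlgebra.frac c jj l) with hq
    set q' : Fin r → F₂.presheaf.stalk y := fun l => χ' (blowupAlgebra.frac cb j' l) with hq'
    -- the coefficient maps agree: `ψ ∘ alg = υ^♯ ∘ j^♯ = χ' ∘ alg ∘ j^♯`
    have hcoef : ∀ a : X'.presheaf.stalk (j (υ y)),
        ψ (algebraMap _ _ a) = (υ.stalkMap y).hom ((j.stalkMap (υ y)).hom a) := by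
      intro a
      rw [hψ, RingHom.comp_apply, hχ]
      have h1 : (j₂ ≫ τ).stalkMap y = (X'.presheaf.stalkCongr (.of_eq (by rw [hcomm]))).hom ≫ (υ ≫ j).stalkMap y :=
        Scheme.Hom.stalkMap_congr_hom _ _ hcomm y
      have h2 : ∀ z, (j₂.stalkMap y).hom ((τ.stalkMap (j₂ y)).hom z) = ((j₂ ≫ τ).stalkMap y).hom z := fun z => by
        rw [Scheme.Hom.stalkMap_comp]; rfl
      have h3 : ((X'.presheaf.stalkCongr (.of_eq (by rw [hcomm]) : Inseparable ((j₂ ≫ τ) y) ((υ ≫ j) y))).hom)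
          ((X'.presheaf.stalkCongr (Inseparable.of_eq hτx')).inv a) = a := by
        change ((X'.presheaf.stalkCongr (Inseparable.of_eq hτx')).inv ≫
          (X'.presheaf.stalkCongr (Inseparable.of_eq hτx')).hom) a = a
        rw [Iso.inv_hom_id]; rfl
      have h4 : ∀ b, ((υ ≫ j).stalkMap y).hom b = (υ.stalkMap y).hom ((j.stalkMap (υ y)).hom b) := fun b => by
        rw [Scheme.Hom.stalkMap_comp]; rfl
      rw [h2, h1, CommRingCat.hom_comp, RingHom.comp_apply, ← h4]
      exact congrArg _ h3
    have hcoef' : ∀ a : X'.presheaf.stalk (j (υ y)),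
        χ' (algebraMap _ _ ((j.stalkMap (υ y)).hom a)) = (υ.stalkMap y).hom ((j.stalkMap (υ y)).hom a) :=
      fun a => hχ' _
    -- `a_l = q_l * t = q'_l * t'`
    have hqt : ∀ l, q l * t = (υ.stalkMap y).hom ((j.stalkMap (υ y)).hom (c l)) := by
      intro l
      rw [hq, ht, ← map_mul, mul_comm, blowupAlgebra.algebraMap_mul_gen, hcoef]
    have hqt' : ∀ l, q' l * t' = (υ.stalkMap y).hom ((j.stalkMap (υ y)).hom (c l)) := by
      intro l
      rw [hq', ht', ← map_mul, mul_comm, blowupAlgebra.algebraMap_mul_gen, hcoef']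
    -- `(t) = (t') = E₂_y`, so `t = u * t'` with `u` a unit
    have hspan : Ideal.span {t} = Ideal.span {t'} := by
      have h1 : stalkIdeal ((vanishingIdeal ⟨{υ y}, hx⟩ : F₁.IdealSheafData).comap υ) y = Ideal.span {t} := by
        rw [← hE, stalkIdeal_comap_eq_map_stalkMap, hEu, Ideal.map_span, Set.image_singleton]
        rfl
      rw [← h1, hEd]
    obtain ⟨u, hu⟩ : Associated t' t := (Ideal.span_singleton_eq_span_singleton.mp hspan).symm
    -- `t' ≠ 0`: a member of the quasi-regular `cb`, transported by the injective `υ^♯_y`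
    have ht'0 : t' ≠ 0 := by
      rw [ht', hχ']
      intro h0
      have h1 : cb j' = 0 := hυ.stalkMap_injective y (h0.trans (map_zero _).symm)
      exact ne_zero_of_isQuasiRegular hcbar (by rw [hcb𝔪]; exact (maximalIdeal.isMaximal _).ne_top) j' h1
    -- `q' = u • q`
    have hqq : q' = (u : F₂.presheaf.stalk y) • q := by
      funext l
      have h1 : q' l * t' = ((u : F₂.presheaf.stalk y) * q l) * t' := by
        rw [hqt', ← hqt l, ← hu]; ring
      simp only [Pi.smul_apply, smul_eq_mul]
      exact mul_right_cancel₀ ht'0 h1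
    -- the two forms, evaluated
    set P : MvPolynomial (Fin r) (F₂.presheaf.stalk y) :=
      MvPolynomial.map ((υ.stalkMap y).hom.comp (j.stalkMap (υ y)).hom) Φ with hP
    have hPd : P.IsHomogeneous d := hΦd.map _
    have hψalg : ψ.comp (algebraMap _ (blowupAlgebra (Ideal.span (Set.range c)) (c jj))) =
        (υ.stalkMap y).hom.comp (j.stalkMap (υ y)).hom := RingHom.ext fun a => hcoef a
    have hχ'alg : (χ'.comp (algebraMap _ (blowupAlgebra (Ideal.span (Set.range cb)) (cb j')))).comp
        (j.stalkMap (υ y)).hom = (υ.stalkMap y).hom.comp (j.stalkMap (υ y)).hom := RingHom.ext fun a => hcoef' a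
    have hup : ψ (MvPolynomial.aeval (blowupAlgebra.frac c jj) Φ) = MvPolynomial.eval q P := by
      rw [MvPolynomial.aeval_def, MvPolynomial.eval₂_comp_left, hψalg, hP, MvPolynomial.eval_map]
      rfl
    have hdown : χ' (MvPolynomial.aeval (blowupAlgebra.frac cb j') Φb) =
        (u : F₂.presheaf.stalk y) ^ d * MvPolynomial.eval q P := by
      rw [MvPolynomial.aeval_def, MvPolynomial.eval₂_comp_left, hΦb, MvPolynomial.eval₂_map, hχ'alg,
        ← MvPolynomial.eval_map, ← hP, ← eval_smul_of_isHomogeneous' hPd, ← hqq]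
      rfl
    -- conclude at `y`
    rw [stalkIdeal_comap_eq_map_stalkMap, hStu, Ideal.map_span, Set.image_singleton, hStd]
    change Ideal.span {ψ _} = Ideal.span {χ' _}
    rw [hup, hdown, Ideal.span_singleton_mul_left_unit (u.isUnit.pow d)]
  · -- off the exceptional locus both sides are the total transform `(K · 𝒪_{F₁}) · 𝒪_{F₂} = (K · 𝒪_{X₁}) · 𝒪_{F₂}`
    have hyE : y ∉ ((vanishingIdeal ⟨{x}, hx⟩ : F₁.IdealSheafData).comap υ).support := by
      intro h
      have h' : y ∈ (((vanishingIdeal ⟨{x}, hx⟩ : F₁.IdealSheafData).comap υ).support : Set F₂) := h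
      rw [Scheme.IdealSheafData.support_comap, TopologicalSpace.Closeds.coe_preimage,
        Scheme.IdealSheafData.coe_support_vanishingIdeal] at h'
      exact hy h'
    have hyE' : j₂ y ∉ (J.comap τ).support := by
      intro h
      apply hyE
      have h' : y ∈ (((J.comap τ).comap j₂).support : Set F₂) := by
        rw [Scheme.IdealSheafData.support_comap]
        exact h
      rw [hE] at h'
      exact h'
    have hR : stalkIdeal (strictTransformIdeal υ (vanishingIdeal ⟨{x}, hx⟩) (K.comap j)) y =
        stalkIdeal ((K.comap j).comap υ) y := by
      rw [stalkIdeal_strictTransformIdeal_of_not_mem _ _ (K.comap j) hyE, ← stalkIdeal_comap_eq_map_stalkMap]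
    have hL : stalkIdeal ((strictTransformIdeal τ J K).comap j₂) y = stalkIdeal ((K.comap τ).comap j₂) y := by
      rw [stalkIdeal_comap_eq_map_stalkMap, stalkIdeal_strictTransformIdeal_of_not_mem _ _ K hyE',
        ← stalkIdeal_comap_eq_map_stalkMap, ← stalkIdeal_comap_eq_map_stalkMap]
    rw [hL, hR, ← Scheme.IdealSheafData.comap_comp, ← Scheme.IdealSheafData.comap_comp, hcomm]

end Summit.ResolutionOfSingularities.ResolutionOfSingularities.Cruxes.EquisingularLiftNat.Sections

end
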